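import Mathlib
import Summits.HodgeConjecture.HodgeConjecture.Theorems.HodgeLocusCensusUnitColumnRank
import Summits.HodgeConjecture.HodgeConjecture.Theorems.HodgeLocusCensusUnitColumnRankC1All

/-!
# Hodge-locus census — THEOREM K-MODEL's `d = 4` CELLS AS KERNEL RANK THEOREMS: `×q` ON `F_{4;1,k′}` (EVERY `k′`) AND `×q²` ON `F_{4;2,k′}`
(def-free, certificate-free, theorem-only helper of `stmt-HodgeConjecture-16267`; pub-hlocus, seat ivhs-2 = ENGINE B, gen 45, item B45-R″;
record `pub-hlocus-ivhs-2/gen45/ENGINEB-g45.md`; companion of the ENGINE B anchors `HodgeLocusCensusUnitColumnRank.lean` (anchor 168: LAYER A,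
general rank lemmas over an arbitrary field — `card_le_rank_of_det_ne_zero` APPLIED here by name), `HodgeLocusCensusUnitColumnRankC1All.lean`
(anchor 172: `c′ = 1`, every `k′ ≥ 3`, `d ≥ 5` — its count `card_target` (every `d ≥ 4`) APPLIED here by name) and
`HodgeLocusCensusModelNonJumpC1All.lean` (gen 31: THEOREM K-MODEL — its column-support function `colR` and `colR_pos` APPLIED here by name);
nothing of theirs is restated.)

Setting (the record's, `ENGINEB-g31.md` §11a).  Cell `(2k′, d, k′-1)`, `B = K[x_1..x_{k′}]/(x_i^{d-1})`, restricted transition form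
`q = Σ_i x_i^{d-2}`, Kronecker index `ρ = rank(×q^{c′} : B_{s-d} → B_{t-d})`.  The anchors kernel-check the rank statement of THEOREM K-MODEL for
`c′ = 1`, every `d ≥ 5` (anchor 168: `k′ = 2`; anchor 172: every `k′ ≥ 3`); for `c′ ≥ 2`, `d ≥ 5` the target `B_{t-d}` is zero.  The remaining cells
with `d ≥ 4`, `dim B_{t-d} > 0` are the `d = 4` cells of §11a — case (1) at `d = 4` (`c′ = 1`: `B = K[x]/(x_i³)`, `q = Σ x_i²`,
`×q : B_{2k′-4} → B_{2k′-2}`) and case (2) (`c′ = 2`: `×q² : B_{2k′-4} → B_{2k′}`, the socle) — where the columns of `×q` are no longer unit vectors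
(`m = (0,0,2,…)` has `q·x^m = x_1²x^m + x_2²x^m`), so anchor 168's covering-unit-columns lemma does not apply as such.  This file kernel-checks them
for EVERY `k′ = k` at once, in anchor 172's convention: rows/columns = exponent functions `Fin k → Fin 3` of the right mass; the entry of `×q` at
`(v, m)` is `[List.ofFn v ∈ colR 4 (List.ofFn m)]` (= the coefficient: `indicator_eq_count_colR`); the entry of `×q²` is the multiplicity of
`List.ofFn v` in `(colR 4 (List.ofFn m)).flatMap (colR 4)` (= the coefficient of `x^v` in `q·(q·x^m)`).
* LAYER A+ `rank_eq_card_of_single_mem_span_cols` (every unit vector `e_s` in the column span ⇒ full row rank; anchor 168's (γ) is the case "`e_s` is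
  a column"), `single_eq_half_comb` (`[P] = ½([Q∨P] + [R∨P] - [R∨Q])`, the one place `2` is inverted); BRIDGE `mem_colR_iff` / `ofFn_mem_colR_iff`
  (membership in `colR d m` = raising ONE zero exponent to `d-2`, every `d`), `colR_nodup` (`d ≥ 3`); `d = 4` COMBINATORICS `sum_levels` (masses),
  `row_shape_d4` (a monomial of `B_{2k-2}` has ONE exponent `0` or TWO exponents `1`, all others `2`), `card_top_eq_one` (`dim B_{2k} = 1`),
  `entry_pair_iff` (the column of `m` with zeros at `x ≠ y` is `e_{r_x} + e_{r_y}`, `r_z` = the row with its `0` at `z`), `entry_single_iff` (the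
  column of `m = (0 at c, 1 at a, b)` is a unit vector);
* THEOREM (i) `rank_mulDelta_modelC1_d4` (§11a case (1), `d = 4`, every `k ≥ 3`, `(2 : K) ≠ 0`): `×q : B_{2k-4} → B_{2k-2}` has `Matrix.rank =
  Fintype.card rows = k(k+1)/2` (`card_rows_d4`, `…_eq_choose`; `≤ Fintype.card cols`, `card_rows_le_card_cols_d4`, i.e. rank `= min (dim source)
  (dim target)`): a two-ones row is a unit column, a one-zero row `r_a` is `½·(col m_{ab} + col m_{ac} - col m_{bc})`;
* THEOREM (ii) `rank_mulDelta_modelC1_d4_two` (cell `(4,4,1)`, `k = 2`, every field): rank `1 = dim B_{s-d}` (`3` rows, `1` column: `card_d4_two`);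
* THEOREM (iii) `rank_mulDeltaSq_modelC2_d4` (§11a case (2), `c′ = 2`, `d = 4`, every `k ≥ 2`, `(2 : K) ≠ 0`): `×q² : B_{2k-4} → B_{2k}` has rank
  `1 = dim B_{2k}` (the entry at `m = (0,0,2,…,2)` is `2`, `count_flatMap_colR_pair`).
`(2 : K) ≠ 0` in (i), (iii) is NECESSARY: in characteristic `2` the one-zero rows see only the incidence matrix of the complete graph `K_k` (rank
`k-1`), and `q² = 2·Σ_{i<j} x_i²x_j² = 0` in `B`; THEOREM K-MODEL is a characteristic-`0` statement.  With anchors 168 and 172 the rank statement of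
THEOREM K-MODEL is a kernel theorem in every cell with `d ≥ 4` and `dim B_{t-d} > 0`; the `d = 3` cells (§11a case (3)) are NOT treated here.
Scope (said plainly).  Statements about explicit matrices read off the gen-31 anchor's support function `colR`; that these ranks are the `ρ` of
THEOREM K⁼ / K-MODEL is the record's seat-proved, LEAD/referee-read step and stays outside Lean, as in the anchors.  Evidence-class upgrade of existing
record statements only; no census number changes; nothing about Hodge loci beyond the K-MODEL record; nothing about HC.

certified instances and evidence bearing on the general Hodge conjecture; no claim.
-/

set_option linter.dupNamespace false
set_option autoImplicit false

namespace Summit.HodgeConjecture.HodgeConjecture.HodgeLocus.Census.UnitColumnRankD4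

open Summit.HodgeConjecture.HodgeConjecture.HodgeLocus.Census.ModelNonJumpC1All (colR colR_pos)
open Summit.HodgeConjecture.HodgeConjecture.HodgeLocus.Census.UnitColumnRank (card_le_rank_of_det_ne_zero)
open Summit.HodgeConjecture.HodgeConjecture.HodgeLocus.Census.UnitColumnRankC1All (card_target)

/-! ## LAYER A+ — unit vectors in the column span ⇒ full row rank (arbitrary field) -/

section LayerA

variable {K : Type*} [Field K] {m n : Type*} [Fintype n]

/-- If every unit vector `e_s` lies in the `K`-span of the columns of `A`, then `rank A = #rows` (full row rank). -/
theorem rank_eq_card_of_single_mem_span_cols [Fintype m] [DecidableEq m] (A : Matrix m n K)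
    (h : ∀ s : m, (Pi.single s (1 : K) : m → K) ∈ Submodule.span K (Set.range A.col)) : A.rank = Fintype.card m := by
  rw [Matrix.rank_eq_finrank_span_cols]
  have htop : Submodule.span K (Set.range A.col) = ⊤ := by
    rw [eq_top_iff, ← (Pi.basisFun K m).span_eq, Submodule.span_le]
    rintro _ ⟨s, rfl⟩; rw [Pi.basisFun_apply]; exact h s
  rw [htop, finrank_top, Module.finrank_fintype_fun_eq_card]

/-- for pairwise exclusive conditions `P, Q, R`: `[P] = ½·([Q ∨ P] + [R ∨ P] - [R ∨ Q])` (the only use of `(2 : K) ≠ 0` in THEOREM (i)). -/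
theorem single_eq_half_comb (h2 : (2 : K) ≠ 0) {P Q R : Prop} [Decidable P] [Decidable (Q ∨ P)] [Decidable (R ∨ P)]
    [Decidable (R ∨ Q)] (hPQ : ¬ (P ∧ Q)) (hPR : ¬ (P ∧ R)) (hQR : ¬ (Q ∧ R)) : (if P then (1 : K) else 0) =
      (2 : K)⁻¹ * ((if Q ∨ P then (1 : K) else 0) + (if R ∨ P then (1 : K) else 0) - (if R ∨ Q then (1 : K) else 0)) := by
  by_cases hp : P
  · rw [if_pos hp, if_pos (Or.inr hp), if_pos (Or.inr hp), if_neg (fun h => h.elim (fun hr => hPR ⟨hp, hr⟩) (fun hq => hPQ ⟨hp, hq⟩)),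
      sub_zero, one_add_one_eq_two, inv_mul_cancel₀ h2]
  rw [if_neg hp]
  by_cases hq : Q
  · rw [if_pos (Or.inl hq), if_neg (fun h => h.elim (fun hr => hQR ⟨hq, hr⟩) hp), if_pos (Or.inr hq)]; ring
  by_cases hr : R
  · rw [if_neg (fun h => h.elim hq hp), if_pos (Or.inl hr), if_pos (Or.inl hr)]; ring
  rw [if_neg (fun h => h.elim hq hp), if_neg (fun h => h.elim hr hp), if_neg (fun h => h.elim hr hq)]; ring

end LayerA

/-! ## BRIDGE — membership in the anchor's column list `colR` -/

/-- `w ∈ colR d m` iff `w` is `m` with ONE zero entry raised to `d - 2` (every `d`). -/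
theorem mem_colR_iff (d : ℕ) : ∀ (m w : List ℕ), w ∈ colR d m ↔ ∃ i : ℕ, ∃ h : i < m.length, m[i] = 0 ∧ w = m.set i (d - 2)
  | [], w => by simp [colR]
  | x :: m, w => by
      rw [colR, List.mem_append, List.mem_map]
      constructor
      · rintro (h | ⟨w', hw', rfl⟩)
        · split_ifs at h with hx
          · exact ⟨0, by simp, by simpa using hx, by simpa using h⟩
          · simp at h
        · obtain ⟨i, hi, h0, rfl⟩ := (mem_colR_iff d m w').mp hw'
          exact ⟨i + 1, by simpa using hi, by simpa using h0, by simp⟩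
      · rintro ⟨_ | j, hi, h0, rfl⟩
        · simp only [List.getElem_cons_zero] at h0
          simp [h0]
        · exact Or.inr ⟨m.set j (d - 2), (mem_colR_iff d m _).mpr ⟨j, by simpa using hi, by simpa using h0, rfl⟩, by simp⟩

/-- `colR d m` has no duplicates (`d ≥ 3`: the raised entry `d - 2 ≠ 0` pins down which zero was raised) … -/
theorem colR_nodup (d : ℕ) (hd : 3 ≤ d) : ∀ m : List ℕ, (colR d m).Nodup
  | [] => by simp [colR]
  | x :: m => by
      rw [colR]
      refine List.Nodup.append (by split_ifs <;> simp) ((colR_nodup d hd m).map fun a b h => List.cons_injective h) fun w hw hw' => ?_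
      split_ifs at hw with hx
      · rw [List.mem_map] at hw'
        obtain ⟨w', -, rfl⟩ := hw'
        have := (List.cons.inj (List.mem_singleton.mp hw)).1
        omega
      · simp at hw

/-- … hence the indicator entry `[w ∈ colR d m]` IS the multiplicity of `w` in `colR d m`, the coefficient of `x^w` in `q·x^m` (`d ≥ 3`). -/
theorem indicator_eq_count_colR (K : Type*) [Field K] (d : ℕ) (hd : 3 ≤ d) (m w : List ℕ) :
    (if w ∈ colR d m then (1 : K) else 0) = ((colR d m).count w : K) := by
  by_cases h : w ∈ colR d m
  · rw [if_pos h, List.count_eq_one_of_mem (colR_nodup d hd m) h, Nat.cast_one]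
  · rw [if_neg h, List.count_eq_zero.mpr h, Nat.cast_zero]

/-- `mem_colR_iff` in exponent-function coordinates: `x^v` occurs in the column of `x^m` iff `v` is `m` with one zero exponent raised to `d - 2`. -/
theorem ofFn_mem_colR_iff {k d : ℕ} (m v : Fin k → Fin (d - 1)) :
    List.ofFn (fun l => (v l : ℕ)) ∈ colR d (List.ofFn (fun l => (m l : ℕ))) ↔
      ∃ i : Fin k, (m i : ℕ) = 0 ∧ (v i : ℕ) = d - 2 ∧ ∀ l, l ≠ i → v l = m l := by
  rw [mem_colR_iff]
  constructor
  · rintro ⟨i, hi, h0, hw⟩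
    rw [List.length_ofFn] at hi
    have hj : ∀ (j : ℕ) (hj : j < k), (v ⟨j, hj⟩ : ℕ) = if i = j then d - 2 else (m ⟨j, hj⟩ : ℕ) := fun j hj => by
      have e := List.getElem_of_eq hw (i := j) (by simpa using hj)
      simpa [List.getElem_set] using e
    refine ⟨⟨i, hi⟩, by simpa using h0, by simpa using hj i hi, fun l hl => ?_⟩
    exact Fin.ext (by simpa [show ¬ i = (l : ℕ) from fun h => hl (Fin.ext h.symm)] using hj l l.2)
  · rintro ⟨i, h0, hv, hoff⟩
    refine ⟨i, by simp, by simpa using h0, List.ext_getElem (by simp) fun j h1 h2 => ?_⟩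
    simp only [List.getElem_ofFn, List.getElem_set]
    split_ifs with hij
    · have : (⟨j, by simpa using h1⟩ : Fin k) = i := Fin.ext hij.symm
      rw [← hv, ← this]
    · have hne : (⟨j, by simpa using h1⟩ : Fin k) ≠ i := fun h => hij (by rw [← h])
      simp [hoff _ hne]

/-! ## `d = 4` combinatorics of exponent functions `Fin k → Fin 3` -/

/-- mass of a three-level exponent function: `0` on `S`, `1` on `T`, `2` elsewhere (`S`, `T` disjoint). -/
theorem sum_levels {k : ℕ} (S T : Finset (Fin k)) (hST : Disjoint S T) :
    (∑ l : Fin k, ((if l ∈ S then (0 : Fin 3) else if l ∈ T then 1 else 2 : Fin 3) : ℕ)) + 2 * S.card + T.card = k * 2 := by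
  have h2 : ∀ l : Fin k, ((if l ∈ S then (0 : Fin 3) else if l ∈ T then 1 else 2 : Fin 3) : ℕ) +
      ((if l ∈ S then 2 else 0) + (if l ∈ T then 1 else 0)) = 2 := fun l => by
    by_cases hS : l ∈ S
    · simp [hS, Finset.disjoint_left.mp hST hS]
    · by_cases hT : l ∈ T <;> simp [hS, hT]
  have h3 := Finset.sum_congr rfl (fun l (_ : l ∈ Finset.univ) => h2 l)
  rw [Finset.sum_add_distrib, Finset.sum_add_distrib, Finset.sum_ite_mem, Finset.sum_ite_mem, Finset.univ_inter,
    Finset.univ_inter] at h3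
  simp only [Finset.sum_const, smul_eq_mul, Finset.card_univ, Fintype.card_fin] at h3
  omega

/-- the column exponent function with zeros at `x ≠ y` (all other exponents `2`) has mass `2k - 4`: a monomial of `B_{2k-4}` -/
theorem sum_pair {k : ℕ} (x y : Fin k) (hxy : x ≠ y) :
    (∑ l : Fin k, ((if l = x ∨ l = y then (0 : Fin 3) else 2 : Fin 3) : ℕ)) + 4 = k * 2 := by
  have h := sum_levels ({x, y} : Finset (Fin k)) ∅ (Finset.disjoint_empty_right _)
  rw [Finset.card_pair hxy] at h
  simpa using h

/-- the column with a `0` at `c` and ones at `a ≠ b` (`c ≠ a, b`) has mass `2k - 4` -/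
theorem sum_zero_ones_at {k : ℕ} (a b c : Fin k) (hab : a ≠ b) (hca : c ≠ a) (hcb : c ≠ b) :
    (∑ l : Fin k, ((if l = c then (0 : Fin 3) else if l = a ∨ l = b then 1 else 2 : Fin 3) : ℕ)) + 4 = k * 2 := by
  have h := sum_levels ({c} : Finset (Fin k)) ({a, b} : Finset (Fin k)) (by simp [hca, hcb])
  rw [Finset.card_pair hab, Finset.card_singleton] at h
  simp only [Finset.mem_singleton, Finset.mem_insert] at h
  omega

/-- ROW SHAPE at `d = 4`: a target exponent function (mass `2k - 2`) has ONE entry `0` and all others `2`, or TWO entries `1` and all others `2`. -/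
theorem row_shape_d4 {k : ℕ} (v : Fin k → Fin 3) (hv : (∑ i, (v i : ℕ)) + 2 = k * 2) :
    (∃ a : Fin k, (v a : ℕ) = 0 ∧ ∀ l, l ≠ a → (v l : ℕ) = 2) ∨
    (∃ a b : Fin k, a ≠ b ∧ (v a : ℕ) = 1 ∧ (v b : ℕ) = 1 ∧ ∀ l, l ≠ a → l ≠ b → (v l : ℕ) = 2) := by
  have hle : ∀ l, (v l : ℕ) ≤ 2 := fun l => by have := (v l).2; omega
  -- the deficits `2 - v l` have total mass `2`
  have hD : ∑ l, (2 - (v l : ℕ)) = 2 := by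
    have h : ∑ l, ((2 - (v l : ℕ)) + (v l : ℕ)) = k * 2 := by rw [Finset.sum_congr rfl (fun l _ => Nat.sub_add_cancel (hle l))]; simp
    rw [Finset.sum_add_distrib] at h; omega
  have h2le : ∀ a b : Fin k, a ≠ b → (2 - (v a : ℕ)) + (2 - (v b : ℕ)) ≤ 2 := fun a b hab => by
    have h := Finset.sum_le_sum_of_subset (f := fun l => 2 - (v l : ℕ)) (Finset.subset_univ {a, b})
    rw [Finset.sum_pair hab] at h
    omega
  by_cases hA : ∃ a, (v a : ℕ) = 0
  · obtain ⟨a, ha⟩ := hA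
    exact Or.inl ⟨a, ha, fun l hl => by have := h2le a l (Ne.symm hl); have := hle l; omega⟩
  right
  push Not at hA
  obtain ⟨a, -, ha⟩ := Finset.exists_ne_zero_of_sum_ne_zero (hD.trans_ne two_ne_zero)
  have hea := Finset.add_sum_erase Finset.univ (fun l => 2 - (v l : ℕ)) (Finset.mem_univ a)
  obtain ⟨b, hb, hb0⟩ := Finset.exists_ne_zero_of_sum_ne_zero
    (s := Finset.univ.erase a) (f := fun l => 2 - (v l : ℕ)) (by have := hA a; omega)
  have hba : b ≠ a := (Finset.mem_erase.mp hb).1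
  refine ⟨a, b, hba.symm, by have := hA a; omega, by have := hA b; omega, fun l hla hlb => ?_⟩
  have heb := Finset.add_sum_erase _ (fun l => 2 - (v l : ℕ)) hb
  have hl := Finset.single_le_sum (f := fun l => 2 - (v l : ℕ)) (fun _ _ => Nat.zero_le _)
    (Finset.mem_erase.mpr ⟨hlb, Finset.mem_erase.mpr ⟨hla, Finset.mem_univ l⟩⟩)
  have := hA a; have := hA b; have := hle l
  omega

/-- the only exponent function of mass `2k` is the top one (all exponents `2`): `dim B_{2k} = 1`, the socle. -/
theorem card_top_eq_one (k : ℕ) : Fintype.card {v : Fin k → Fin 3 // (∑ i, (v i : ℕ)) = k * 2} = 1 := by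
  refine Fintype.card_eq_one_iff.mpr ⟨⟨fun _ => 2, by simp⟩, fun ⟨y, hy⟩ => Subtype.ext (funext fun l => ?_)⟩
  have hle : ∀ l, (y l : ℕ) ≤ 2 := fun l => by have := (y l).2; omega
  have h : ∑ l, ((2 - (y l : ℕ)) + (y l : ℕ)) = k * 2 := by rw [Finset.sum_congr rfl (fun l _ => Nat.sub_add_cancel (hle l))]; simp
  have := Finset.single_le_sum (f := fun l => 2 - (y l : ℕ)) (fun _ _ => Nat.zero_le _) (Finset.mem_univ l)
  rw [Finset.sum_add_distrib, hy] at h; have := hle l; exact Fin.ext (by simp; omega)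

/-- a third index besides `a`, `b` exists when `k ≥ 3` … -/
theorem exists_third {k : ℕ} (hk : 3 ≤ k) (a b : Fin k) : ∃ c : Fin k, c ≠ a ∧ c ≠ b := by
  by_cases h0 : (a : ℕ) ≠ 0 ∧ (b : ℕ) ≠ 0
  · exact ⟨⟨0, by omega⟩, by simp [Fin.ext_iff]; omega, by simp [Fin.ext_iff]; omega⟩
  by_cases h1 : (a : ℕ) ≠ 1 ∧ (b : ℕ) ≠ 1
  · exact ⟨⟨1, by omega⟩, by simp [Fin.ext_iff]; omega, by simp [Fin.ext_iff]; omega⟩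
  exact ⟨⟨2, by omega⟩, by simp [Fin.ext_iff]; omega, by simp [Fin.ext_iff]; omega⟩

/-- … hence two further indices besides `a`, pairwise distinct. -/
theorem exists_two_others {k : ℕ} (hk : 3 ≤ k) (a : Fin k) : ∃ b c : Fin k, a ≠ b ∧ a ≠ c ∧ b ≠ c := by
  obtain ⟨b, hba, -⟩ := exists_third hk a a; obtain ⟨c, hca, hcb⟩ := exists_third hk a b
  exact ⟨b, c, hba.symm, hca.symm, hcb.symm⟩

/-- ENTRY OF A (2,2)-PATTERN COLUMN (zeros at `x ≠ y`, other exponents `2`): `x^w` occurs in the column of `×q` iff `w` is the row with its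
single `0` at `y` or at `x` (the two surviving products `x_x²·x^m`, `x_y²·x^m`): the column is `e_{r_x} + e_{r_y}`, NOT a unit vector. -/
theorem entry_pair_iff {k : ℕ} (x y : Fin k) (hxy : x ≠ y) (w : Fin k → Fin 3) :
    List.ofFn (fun l => (w l : ℕ)) ∈ colR 4 (List.ofFn (fun l => ((if l = x ∨ l = y then (0 : Fin 3) else 2 : Fin 3) : ℕ))) ↔
      ((w = fun l => if l = y then (0 : Fin 3) else 2) ∨ (w = fun l => if l = x then (0 : Fin 3) else 2)) := by
  rw [ofFn_mem_colR_iff (d := 4) (fun l => (if l = x ∨ l = y then (0 : Fin 3) else 2 : Fin 3)) w]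
  constructor
  · rintro ⟨i, hi0, hi2, hoff⟩
    have hi : i = x ∨ i = y := by by_contra h; push Not at h; simp [h.1, h.2] at hi0
    rcases hi with rfl | rfl
    · refine Or.inl (funext fun l => ?_)
      by_cases hl : l = i
      · subst hl
        rw [if_neg (show ¬ l = y from hxy)]
        exact Fin.ext (by simpa using hi2)
      · rw [hoff l hl]
        by_cases hly : l = y <;> simp [hl, hly]
    · refine Or.inr (funext fun l => ?_)
      by_cases hl : l = i
      · subst hl
        rw [if_neg (show ¬ l = x from fun h => hxy h.symm)]
        exact Fin.ext (by simpa using hi2)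
      · rw [hoff l hl]
        by_cases hlx : l = x <;> simp [hl, hlx]
  · rintro (rfl | rfl)
    · exact ⟨x, by simp, by simp [hxy], fun l hl => by by_cases hly : l = y <;> simp [hl, hly]⟩
    · exact ⟨y, by simp, by simp [Ne.symm hxy], fun l hl => by by_cases hlx : l = x <;> simp [hl, hlx]⟩

/-- ENTRY OF A (2,1,1)-PATTERN COLUMN (zero at `c`, ones at `a`, `b`, both `≠ c`, other exponents `2`): `x^w` occurs in its column iff `w` is
the row with ones at `a`, `b` (the single surviving product `x_c²·x^m`): a UNIT column. -/
theorem entry_single_iff {k : ℕ} (a b c : Fin k) (hca : c ≠ a) (hcb : c ≠ b) (w : Fin k → Fin 3) :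
    List.ofFn (fun l => (w l : ℕ)) ∈
        colR 4 (List.ofFn (fun l => ((if l = c then (0 : Fin 3) else if l = a ∨ l = b then 1 else 2 : Fin 3) : ℕ))) ↔
      (w = fun l => if l = a ∨ l = b then (1 : Fin 3) else 2) := by
  rw [ofFn_mem_colR_iff (d := 4) (fun l => (if l = c then (0 : Fin 3) else if l = a ∨ l = b then 1 else 2 : Fin 3)) w]
  constructor
  · rintro ⟨i, hi0, hi2, hoff⟩
    have hi : i = c := by by_contra h; by_cases h' : i = a ∨ i = b <;> simp [h, h'] at hi0
    subst hi
    refine funext fun l => ?_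
    by_cases hl : l = i
    · subst hl
      rw [if_neg (fun h => h.elim hca hcb)]; exact Fin.ext (by simpa using hi2)
    · simp [hoff l hl, hl]
  · rintro rfl
    exact ⟨c, by simp, by simp [hca, hcb], fun l hl => by simp [hl]⟩

/-! ## THEOREM (i) — §11a case (1) at `d = 4`, every `k′ ≥ 3`: `×q : B_{2k-4} → B_{2k-2}` has full row rank -/

/-- THEOREM (i).  Over every field `K` with `(2 : K) ≠ 0`, for every `k ≥ 3`: the matrix of `×q` (`q = Σ_i x_i²`) from `B_{2k-4}` to `B_{2k-2}` in
`B = K[x_1..x_k]/(x_i³)` — rows `{v : Fin k → Fin 3 // Σ v_i + 2 = 2k}`, columns `{m // Σ m_i + 4 = 2k}`, entry `[List.ofFn v ∈ colR 4 (List.ofFn m)]`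
— has `Matrix.rank = Fintype.card rows` (FULL ROW RANK, `ρ(F_{4;1,k′}) = dim B_{t-d}`): every `e_s` is in the column span — a two-ones row IS a
column (`entry_single_iff`), a one-zero row `r_a` is `½·(col m_{ab} + col m_{ac} - col m_{bc})` (`entry_pair_iff`, `single_eq_half_comb`). -/
theorem rank_mulDelta_modelC1_d4 (K : Type*) [Field K] (h2 : (2 : K) ≠ 0) (k : ℕ) (hk : 3 ≤ k) :
    (Matrix.of fun (v : {v : Fin k → Fin 3 // (∑ i, (v i : ℕ)) + 2 = k * 2})
        (m : {m : Fin k → Fin 3 // (∑ i, (m i : ℕ)) + 4 = k * 2}) =>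
      if List.ofFn (fun i => (v.1 i : ℕ)) ∈ colR 4 (List.ofFn (fun i => (m.1 i : ℕ))) then (1 : K) else 0).rank =
      Fintype.card {v : Fin k → Fin 3 // (∑ i, (v i : ℕ)) + 2 = k * 2} := by
  set A := (Matrix.of fun (v : {v : Fin k → Fin 3 // (∑ i, (v i : ℕ)) + 2 = k * 2})
        (m : {m : Fin k → Fin 3 // (∑ i, (m i : ℕ)) + 4 = k * 2}) =>
      if List.ofFn (fun i => (v.1 i : ℕ)) ∈ colR 4 (List.ofFn (fun i => (m.1 i : ℕ))) then (1 : K) else 0) with hA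
  have colA : ∀ (c : {m : Fin k → Fin 3 // (∑ i, (m i : ℕ)) + 4 = k * 2}) (w : {v : Fin k → Fin 3 // (∑ i, (v i : ℕ)) + 2 = k * 2}),
      A.col c w = if List.ofFn (fun i => (w.1 i : ℕ)) ∈ colR 4 (List.ofFn (fun i => (c.1 i : ℕ))) then (1 : K) else 0 :=
    fun _ _ => rfl
  -- the (2,2)-pattern columns `m_{xy}`: `e_{r_x} + e_{r_y}` is in the column span
  have hpair : ∀ x y : Fin k, x ≠ y →
      (fun w : {v : Fin k → Fin 3 // (∑ i, (v i : ℕ)) + 2 = k * 2} =>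
        if (w.1 = fun l => if l = y then (0 : Fin 3) else 2) ∨ (w.1 = fun l => if l = x then (0 : Fin 3) else 2)
        then (1 : K) else 0) ∈ Submodule.span K (Set.range A.col) := by
    intro x y hxy; refine Submodule.subset_span ⟨⟨fun l => if l = x ∨ l = y then 0 else 2, sum_pair x y hxy⟩, ?_⟩
    funext w; rw [colA]; dsimp only; simp only [entry_pair_iff x y hxy w.1]
  apply rank_eq_card_of_single_mem_span_cols
  rintro ⟨s, hs⟩
  rcases row_shape_d4 s hs with ⟨a, ha0, ha2⟩ | ⟨a, b, hab, ha1, hb1, hrest⟩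
  · -- a one-zero row `r_a`
    obtain ⟨b, c, hab, hac, hbc⟩ := exists_two_others hk a
    have hs' : s = fun l => if l = a then (0 : Fin 3) else 2 := funext fun l => by
      by_cases hl : l = a
      · rw [if_pos hl, hl]; exact Fin.ext (by simpa using ha0)
      · rw [if_neg hl]; exact Fin.ext (by simpa using ha2 l hl)
    subst hs'
    have hne : ∀ x y : Fin k, x ≠ y → (fun l => if l = x then (0 : Fin 3) else 2) ≠ (fun l => if l = y then (0 : Fin 3) else 2) := by
      intro x y hxy h
      simpa [hxy] using congrFun h x
    have hmem := Submodule.smul_mem _ (2 : K)⁻¹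
      (Submodule.sub_mem _ (Submodule.add_mem _ (hpair a b hab) (hpair a c hac)) (hpair b c hbc))
    convert hmem using 1
    funext w
    simp only [Pi.single_apply, Pi.smul_apply, Pi.add_apply, Pi.sub_apply, smul_eq_mul, Subtype.ext_iff]
    exact single_eq_half_comb h2 (fun h => hne a b hab (h.1.symm.trans h.2)) (fun h => hne a c hac (h.1.symm.trans h.2))
      (fun h => hne b c hbc (h.1.symm.trans h.2))
  · -- a two-ones row: a unit column
    obtain ⟨c, hca, hcb⟩ := exists_third hk a b
    have hs' : s = fun l => if l = a ∨ l = b then (1 : Fin 3) else 2 := funext fun l => by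
      by_cases hl : l = a ∨ l = b
      · rw [if_pos hl]
        rcases hl with rfl | rfl
        · exact Fin.ext (by simpa using ha1)
        · exact Fin.ext (by simpa using hb1)
      · rw [if_neg hl]; push Not at hl; exact Fin.ext (by simpa using hrest l hl.1 hl.2)
    subst hs'
    refine Submodule.subset_span ⟨⟨fun l => if l = c then 0 else if l = a ∨ l = b then 1 else 2, sum_zero_ones_at a b c hab hca hcb⟩, ?_⟩
    funext w; rw [colA]; dsimp only; simp only [entry_single_iff a b c hca hcb w.1, Pi.single_apply, Subtype.ext_iff]

/-- COUNT: `dim B_{2k-2} = k(k+1)/2` — anchor 172's `card_target` at `d = 4`. -/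
theorem card_rows_d4 (k : ℕ) : Fintype.card {v : Fin k → Fin 3 // (∑ i, (v i : ℕ)) + 2 = k * 2} = k * (k + 1) / 2 :=
  card_target k 4 le_rfl

/-- THEOREM (i) with the count: `ρ(F_{4;1,k′}) = k′(k′+1)/2` for every `k′ ≥ 3`, `(2 : K) ≠ 0`. -/
theorem rank_mulDelta_modelC1_d4_eq_choose (K : Type*) [Field K] (h2 : (2 : K) ≠ 0) (k : ℕ) (hk : 3 ≤ k) :
    (Matrix.of fun (v : {v : Fin k → Fin 3 // (∑ i, (v i : ℕ)) + 2 = k * 2})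
        (m : {m : Fin k → Fin 3 // (∑ i, (m i : ℕ)) + 4 = k * 2}) =>
      if List.ofFn (fun i => (v.1 i : ℕ)) ∈ colR 4 (List.ofFn (fun i => (m.1 i : ℕ))) then (1 : K) else 0).rank = k * (k + 1) / 2 := by
  rw [rank_mulDelta_modelC1_d4 K h2 k hk, card_rows_d4]

/-- `dim B_{2k-2} ≤ dim B_{2k-4}`, `k ≥ 3` (full row rank over `ℚ` needs enough columns): THEOREM (i) reads `rank = min (dim source) (dim target)`. -/
theorem card_rows_le_card_cols_d4 (k : ℕ) (hk : 3 ≤ k) :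
    Fintype.card {v : Fin k → Fin 3 // (∑ i, (v i : ℕ)) + 2 = k * 2} ≤ Fintype.card {m : Fin k → Fin 3 // (∑ i, (m i : ℕ)) + 4 = k * 2} := by
  rw [← rank_mulDelta_modelC1_d4 ℚ (by norm_num) k hk]
  exact Matrix.rank_le_card_width _

/-! ## THEOREM (ii) — the cell `(4,4,1)`: `k′ = 2` -/

/-- THEOREM (ii).  `k = 2` (cell `(4,4,1)`), every field: the same matrix (`3` rows `x_1², x_1x_2, x_2²`; ONE column, the monomial `1`, with
`q·1 = x_1² + x_2²`) has rank `1 = dim B_{s-d} = min (dim source) (dim target)` (`card_d4_two`) — maximal rank, NOT full row rank. -/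
theorem rank_mulDelta_modelC1_d4_two (K : Type*) [Field K] :
    (Matrix.of fun (v : {v : Fin 2 → Fin 3 // (∑ i, (v i : ℕ)) + 2 = 2 * 2})
        (m : {m : Fin 2 → Fin 3 // (∑ i, (m i : ℕ)) + 4 = 2 * 2}) =>
      if List.ofFn (fun i => (v.1 i : ℕ)) ∈ colR 4 (List.ofFn (fun i => (m.1 i : ℕ))) then (1 : K) else 0).rank = 1 := by
  apply le_antisymm ((Matrix.rank_le_card_width _).trans_eq (by decide))
  -- the `1×1` minor at the row `x_1²` (exponents `(2,0)`) and the column `1` (exponents `(0,0)`) is `1`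
  refine le_trans (by simp) (card_le_rank_of_det_ne_zero (ι := Fin 1) _ (fun _ => ⟨![2, 0], by decide⟩)
    (fun _ => ⟨![0, 0], by decide⟩) ?_)
  rw [Matrix.det_unique, Matrix.submatrix_apply, Matrix.of_apply, if_pos (by decide)]
  exact one_ne_zero

/-- the counts of the cell `(4,4,1)`: `dim B_{t-d} = 3`, `dim B_{s-d} = 1`. -/
theorem card_d4_two : Fintype.card {v : Fin 2 → Fin 3 // (∑ i, (v i : ℕ)) + 2 = 2 * 2} = 3 ∧
    Fintype.card {m : Fin 2 → Fin 3 // (∑ i, (m i : ℕ)) + 4 = 2 * 2} = 1 := ⟨by decide, by decide⟩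

/-! ## THEOREM (iii) — §11a case (2): `c′ = 2`, `d = 4`, every `k′ ≥ 2`: `×q² : B_{2k-4} → B_{2k}` has rank `1` -/

/-- the `×q²` entry at the column `m = (0,0,2,…,2)` and the top row: `q²·x^m = 2·x^{(2,…,2)}` (the two orders of raising the two zeros). -/
theorem count_flatMap_colR_pair (j : ℕ) :
    ((colR 4 (List.ofFn fun l : Fin (j + 2) => ((if l = 0 ∨ l = 1 then (0 : Fin 3) else 2 : Fin 3) : ℕ))).flatMap (colR 4)).count
      (List.ofFn fun l : Fin (j + 2) => (((fun _ => 2 : Fin (j + 2) → Fin 3) l : Fin 3) : ℕ)) = 2 := by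
  have hR : ∀ x ∈ List.replicate j 2, 1 ≤ x := fun x hx => by rw [List.eq_of_mem_replicate hx]; omega
  have e1 : (List.ofFn fun l : Fin (j + 2) => ((if l = 0 ∨ l = 1 then (0 : Fin 3) else 2 : Fin 3) : ℕ)) = 0 :: 0 :: List.replicate j 2 := by
    rw [List.ofFn_succ, List.ofFn_succ]; simp [Fin.ext_iff, List.ofFn_const]
  have e2 : (List.ofFn fun l : Fin (j + 2) => (((fun _ => 2 : Fin (j + 2) → Fin 3) l : Fin 3) : ℕ)) = 2 :: 2 :: List.replicate j 2 := by
    rw [List.ofFn_succ, List.ofFn_succ]; simp [List.ofFn_const]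
  rw [e1, e2]
  simp [colR, colR_pos 4 _ hR]

/-- THEOREM (iii).  Over every field `K` with `(2 : K) ≠ 0`, for every `k ≥ 2`: the multiplicity matrix of `×q² : B_{2k-4} → B_{2k}` — rows
`{v : Fin k → Fin 3 // Σ v_i = 2k}` (the socle monomial only, `card_top_eq_one`), columns `{m // Σ m_i + 4 = 2k}`, entry = multiplicity of `List.ofFn v`
in `(colR 4 (List.ofFn m)).flatMap (colR 4)` (the coefficient of `x^v` in `q·(q·x^m)`) — has rank `1 = dim B_{2k}` (`ρ(F_{4;2,k′}) = dim B_{t-d}`):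
the entry at `m = (0,0,2,…,2)` is `2 ≠ 0` (`count_flatMap_colR_pair`). -/
theorem rank_mulDeltaSq_modelC2_d4 (K : Type*) [Field K] (h2 : (2 : K) ≠ 0) (k : ℕ) (hk : 2 ≤ k) :
    (Matrix.of fun (v : {v : Fin k → Fin 3 // (∑ i, (v i : ℕ)) = k * 2})
        (m : {m : Fin k → Fin 3 // (∑ i, (m i : ℕ)) + 4 = k * 2}) =>
      ((((colR 4 (List.ofFn (fun i => (m.1 i : ℕ)))).flatMap (colR 4)).count (List.ofFn (fun i => (v.1 i : ℕ))) : ℕ) : K)).rank = 1 := by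
  obtain ⟨j, rfl⟩ : ∃ j, k = j + 2 := ⟨k - 2, by omega⟩
  apply le_antisymm ((Matrix.rank_le_card_height _).trans_eq (card_top_eq_one (j + 2)))
  have h01 : (0 : Fin (j + 2)) ≠ 1 := by simp
  refine le_trans (by simp) (card_le_rank_of_det_ne_zero (ι := Fin 1) _ (fun _ => ⟨fun _ => 2, by simp⟩)
    (fun _ => ⟨fun l => if l = 0 ∨ l = 1 then 0 else 2, sum_pair 0 1 h01⟩) ?_)
  rw [Matrix.det_unique, Matrix.submatrix_apply, Matrix.of_apply, count_flatMap_colR_pair j]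
  simpa using h2

end Summit.HodgeConjecture.HodgeConjecture.HodgeLocus.Census.UnitColumnRankD4
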